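import Mathlib.RingTheory.Polynomial.UniqueFactorization
import Mathlib.Algebra.MvPolynomial.Equiv
import Literature.AlgebraicGeometry.Motives.ProjectiveSpaceCells
import Summits.ResolutionOfSingularities.ResolutionOfSingularities.Theorems.EquisingularLiftEquisingularLiftNatTowerRationalDefs
import HarnessLib

/-!
# Route `EquisingularLift`, crux EL♮(3) (stmt-ResolutionOfSingularities-20148) / EL♮ (stmt-…-20038) — revision ₂ clause «the carrier is a curve»:
# a RATIONAL carrier is infinite (`Z₉.Infinite` / `Z.Infinite` for free from `RationalCarrier` / `Z̃ ≅ ℙ¹`)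

res-L1-w45b-lead-2 g2 (lead). OURS; elementary; AI-written. Serves chain authors of the revision-₂ reach predicates (`ReachTower₂`, `ReachDirZero₁`,
`ReachNoseTower₂`, …NatTowerReachTwoDefs p556233): the new conjunct `Z₉.Infinite` (res-D-pv-029 ASK 2026-08-27T18:25:10Z) follows from the
rational-carrier certificate they already supply.
* `infinite_primeSpectrum_polynomial` — a field has infinitely many primes in `k[X]` (Euclid: `X · ∏ gᵢ + 1`);
* `infinite_spec_mvPolynomial_fin_one`, `infinite_projectiveLine` — hence `Spec k[y]` and `ℙ¹_k` (through the standard chart, an open immersion) are infinite;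
* `Set.Infinite.of_rationalCarrier` — `RationalCarrier (redSub F₉ Z₉ hZ₉) → Z₉.Infinite`; `Set.Infinite.of_iso_projectiveLine` — the nose form.
[cite: Hartshorne1977, II Prop. 2.5 (standard charts of ℙⁿ)]
-/

set_option linter.dupNamespace false

noncomputable section

open CategoryTheory AlgebraicGeometry TopologicalSpace Polynomial

namespace Summit.ResolutionOfSingularities.ResolutionOfSingularities.Cruxes.EquisingularLiftNat.Sections

/-- **Euclid for `k[X]`**: the prime spectrum of a polynomial ring over a field is infinite. [OURS · elementary] -/
theorem infinite_primeSpectrum_polynomial (k : Type) [Field k] : Infinite (PrimeSpectrum k[X]) := by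
  by_contra hfin
  rw [not_infinite_iff_finite] at hfin
  haveI : Fintype (PrimeSpectrum k[X]) := Fintype.ofFinite _
  have hgen : ∀ p : PrimeSpectrum k[X], ∃ g : k[X], p.asIdeal = Ideal.span {g} := fun p =>
    ⟨_, (IsPrincipalIdealRing.principal p.asIdeal).span_singleton_generator.symm⟩
  choose g hg using hgen
  classical
  let q : k[X] := ∏ p : PrimeSpectrum k[X], (if g p = 0 then 1 else g p)
  have hq : q ≠ 0 := by
    refine Finset.prod_ne_zero_iff.mpr fun p _ => ?_
    split_ifs with h
    · exact one_ne_zero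
    · exact h
  let f : k[X] := X * q + 1
  have hfdeg : 0 < f.natDegree := by
    have h1 : (X * q).natDegree = q.natDegree + 1 := by
      rw [mul_comm, Polynomial.natDegree_mul_X hq]
    have h2 : f.natDegree = (X * q).natDegree := by
      apply Polynomial.natDegree_add_eq_left_of_natDegree_lt
      rw [h1, Polynomial.natDegree_one]; omega
    omega
  have hfu : ¬ IsUnit f := fun hu => by
    have := Polynomial.natDegree_eq_zero_of_isUnit hu
    omega
  obtain ⟨m, hm, hfm⟩ := Ideal.exists_le_maximal (Ideal.span {f}) ((Ideal.span_singleton_ne_top) hfu)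
  have hfm' : f ∈ m := hfm (Ideal.mem_span_singleton_self f)
  let p₀ : PrimeSpectrum k[X] := ⟨m, hm.isPrime⟩
  have hmp : m = Ideal.span {g p₀} := hg p₀
  have hg0 : g p₀ ≠ 0 := by
    intro h0
    rw [hmp, h0, Ideal.span_singleton_zero] at hfm'
    have : f = 0 := hfm'
    rw [this, Polynomial.natDegree_zero] at hfdeg
    exact lt_irrefl 0 hfdeg
  have hdvd_f : g p₀ ∣ f := by
    rw [← Ideal.mem_span_singleton, ← hmp]; exact hfm'
  have hdvd_q : g p₀ ∣ X * q := by
    refine Dvd.dvd.mul_left ?_ X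
    have : g p₀ = (if g p₀ = 0 then 1 else g p₀) := by rw [if_neg hg0]
    rw [this]
    exact Finset.dvd_prod_of_mem _ (Finset.mem_univ p₀)
  have hdvd1 : g p₀ ∣ 1 := by
    have := (dvd_sub hdvd_f hdvd_q)
    simpa [f] using this
  have hunit : IsUnit (g p₀) := isUnit_of_dvd_one hdvd1
  exact hm.ne_top (by rw [hmp, Ideal.span_singleton_eq_top]; exact hunit)

/-- The affine line `Spec k[y]` (in the chart currency `MvPolynomial (Fin 1) k`) is infinite. [OURS · elementary] -/
theorem infinite_spec_mvPolynomial_fin_one (k : Type) [Field k] :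
    Infinite ↥(Spec (CommRingCat.of (MvPolynomial (Fin 1) k))) := by
  have e : MvPolynomial (Fin 1) k ≃+* k[X] := (MvPolynomial.uniqueAlgEquiv k (Fin 1)).toRingEquiv
  haveI := infinite_primeSpectrum_polynomial k
  exact Infinite.of_injective (PrimeSpectrum.comapEquiv e.symm) (PrimeSpectrum.comapEquiv e.symm).injective

/-- **The projective line over any field is infinite** (through the standard chart `Spec k[y] ⟶ ℙ¹_k`, an open immersion). [OURS · elementary] -/
theorem infinite_projectiveLine (k : Type) [Field k] :
    Infinite ↥((Literature.AlgebraicGeometry.Motives.projectiveSpace 1 k).left) := by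
  haveI := infinite_spec_mvPolynomial_fin_one k
  exact Infinite.of_injective (Literature.AlgebraicGeometry.Motives.ProjectiveSpaceCells.chartι k 1 0).base
    (Literature.AlgebraicGeometry.Motives.ProjectiveSpaceCells.chartι k 1 0).isOpenEmbedding.injective

/-- A closed subset whose reduced subscheme is isomorphic to a projective line is infinite (nose form). [OURS · elementary] -/
theorem Set.Infinite.of_iso_projectiveLine {G : Scheme.{0}} {Z : Set G} {hZ : IsClosed Z} {k : Type} [Field k]
    (e : redSub G Z hZ ≅ (Literature.AlgebraicGeometry.Motives.projectiveSpace 1 k).left) : Z.Infinite := by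
  haveI := infinite_projectiveLine k
  haveI : Infinite ↥(redSub G Z hZ) := Infinite.of_injective e.inv.base e.inv.isOpenEmbedding.injective
  have hrange : Set.range (redSubι G Z hZ).base = Z := by
    rw [Scheme.IdealSheafData.range_subschemeι, Scheme.IdealSheafData.coe_support_vanishingIdeal]
    rfl
  rw [← hrange]
  exact Set.infinite_range_of_injective (redSubι G Z hZ).isClosedEmbedding.injective

/-- **A rational carrier is a curve**: `RationalCarrier (redSub F₉ Z₉ hZ₉) → Z₉.Infinite` — the revision-₂ conjunct for free. [OURS · elementary] -/
theorem Set.Infinite.of_rationalCarrier {F₉ : Scheme.{0}} {Z₉ : Set F₉} {hZ₉ : IsClosed Z₉}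
    (h : RationalCarrier (redSub F₉ Z₉ hZ₉)) : Z₉.Infinite := by
  obtain ⟨k', _, ⟨e⟩⟩ := h
  exact Set.Infinite.of_iso_projectiveLine e

end Summit.ResolutionOfSingularities.ResolutionOfSingularities.Cruxes.EquisingularLiftNat.Sections

end
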